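import Summits.NavierStokesRegularity.FunctionalMining.TopEigGapCutoffLowHeat
import HarnessLib

/-!
# FunctionalMining — PROPOSITION L-λ(η) BELOW `q = 2` ON THE WHOLE TOP-GAP CLASS: the node
# `TopEigGapCoercivePos q η` for every real `6/5 ≤ q < 2` (hence for every real `q ≥ 6/5`), NO amplitude floor

HONEST FRAMING. Search for candidate a priori estimates; no regularity claim. Cell `pub-nsfunc`, prove
seat (gen 32). Nothing about Navier–Stokes solutions is asserted; the subject is the STATIC node
`TopEigGapCoercivePos q η` of `TopEigHeatCoerciveGap.lean` (the no-go seat's Proposition L-λ(η), typed by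
the dictionary): `∃ c > 0`, `c·Φ_q(v) ≤ T_q(v)` for every smooth, divergence-free, zero-mean `v` on `T³`
with `λ₂ ≤ (1−η)λ₁` pointwise (`Φ_q = ∫(λ₁⁺)^q`, `T_q` its heat price). KNOWN IN THE TREE: every real
`q ≥ 2` (`TopEig.topEigGapCoercivePos_of_ge_two`, prove g26/g28); below `2` only on the AMPLITUDE-FLOOR
sub-class `λ₁ ≥ κΦ_q^{1/q}` (`TopEig.topEigHeatCoerciveOn_gap_floor`, `5/3 ≤ q ≤ 2`, prove g28/g31), the
obstruction being located at the zero / small set of `λ₁` (prove DERIVATIVES §51.3/§52.3).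

WHAT IS PROVED HERE (prove DERIVATIVES §56). **`topEigGapCoercivePos_of_lt_two (6/5 ≤ q) (q < 2) (0 < η)`**
and **`topEigGapCoercivePos_of_ge_six_fifths (6/5 ≤ q) (0 < η) : TopEigGapCoercivePos q η`**, with
SIEVELD's corollary `violators_outside_every_gap_of_not_pos_of_ge_six_fifths` (if L-λ(q) fails, `q ≥ 6/5`,
the violators leave EVERY top-gap class). The floor is REMOVED by a cut-off at the level of the moment
itself: with `Λ := Φ_q(v)^{1/q}` and `δ := Λ/4`,
1. the small set is cheap on the MOMENT side — the cut-off multiplier `M^δ_q = H_δ(λ₁)P₁`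
   (`H_δ(s) = G_δ(s)s^{q−2}`, the tree's `cutProjPow`) captures `∫H_δ(λ₁)λ₁ ≥ Φ_q − 2δ∫λ₁^{q−1} ≥ Φ_q −
   2δΛ^{q−1} = Φ_q/2` (Jensen `∫λ₁^{q−1} ≤ Λ^{q−1}`), while on its support `λ₁ ≥ δ`, so the singular factor
   obeys `λ₁^{q−2} ≤ δ^{q−2} = 4^{2−q}Λ^{q−2}` — no pointwise floor is needed;
2. the HEAT side holds at every fixed `δ` WITHOUT error: `∫ρ^δ_q ≤ (4/(q(q−1)))·T_q` for `1 < q ≤ 2`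
   (`integral_cutDensityPow_le_heat_of_le_two` of `TopEigGapCutoffLowHeat`, by the two-level comparison
   `ρ^δ_q ≤ (2/(q−1))ρ^ε_q` of `TopEigGapCutoffLow`, Danskin's formula and the uniform weight error
   `0 ≤ λ₁^{q−1} − H_ε(λ₁) ≤ (2ε)^{q−1}`, `ε → 0⁺`);
3. the GRADIENT side `∑(∂M^δ_q)² ≤ (1/(2η))λ₁^{q−2}ρ^δ_q ≤ (1/(2η))δ^{q−2}ρ^δ_q`, integration by parts against
   the velocity, Cauchy–Schwarz, and the velocity brick `∫‖v‖² ≤ K₀Φ_q^{2/q}` of `TopEigGapCutoffLowHeat`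
   (Sobolev–Poincaré at `(s, r) = (q, 2)`, legal iff `q ≥ 6/5`; Calderón–Zygmund; `|S| ≤ 6λ₁`):
   `Φ_q/2 ≤ √(3δ^{q−2}/(2η)) · √(K₀Φ_q^{2/q}) · √(4T_q/(q(q−1)))`, and `δ^{q−2}Φ_q^{2/q} = 4^{2−q}Φ_q ≤ 4Φ_q`,
   whence `(ηq(q−1)/(96(K₀+1)))·Φ_q ≤ T_q`.
So Proposition L-λ(η) holds for every real `q ≥ 6/5`; the range restriction is only the Sobolev exponent
of the velocity brick. NOT CLAIMED: `1 < q < 6/5`; any value of the best constant; the one-sided node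
`TopEigHeatCoercivePos q` (Lemma L-λ(q), OPEN in the kernel for every real `q > 1`); Navier–Stokes regularity.

[ours]
FILING (prove seat g32, SLOT OWN-B3, granted by LEAD (58g) INBOX l.5704, promoted (58z)(C)/(58aa) l.5779): = staged `pub-nsfunc-prove/staged/g32-own/TopEigGapCoerciveBelowTwo.lean` e4385b312f70f231; this line is the only addition.
-/

noncomputable section

open Filter Topology Matrix Finset MeasureTheory Set
open scoped ContDiff

namespace Summit.NavierStokesRegularity.FunctionalMining

open Literature.Analysis Literature.Analysis.FunctionSpaces Literature.Analysis.FunctionSpaces.Torus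
  SharpClass.DirectorForm Literature.Analysis.Matrix

namespace TopEig

variable {v : UnitAddTorus (Fin 3) → EuclideanSpace ℝ (Fin 3)}

/-! ## 1. The cut-off estimate at a fixed level `δ`, `1 < q ≤ 2` -/

/-- **THE CUT-OFF ESTIMATE BELOW `q = 2`.** For `v` smooth, divergence free on `T³`, `1 < q ≤ 2`,
`0 < η ≤ 1`, `λ₂ ≤ (1−η)λ₁` everywhere, and every `δ > 0`:
`Φ_q − 2δ∫λ₁^{q−1} ≤ √(3δ^{q−2}/(2η)) · √(∫‖v‖²) · √((4/(q(q−1))) T_q)`.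
(Moment side through the velocity with the cut-off multiplier `M^δ_q`, on whose support `λ₁^{q−2} ≤ δ^{q−2}`;
gradient side `TopEigGapCutoffLow`; heat side `TopEigGapCutoffLowHeat`.) [ours] -/
theorem cut_topEigMoment_estimate_of_le_two (hv : Torus.IsSmooth v) (hdiv : Torus.IsDivFree v)
    {q : ℝ} (hq1 : 1 < q) (hq2 : q ≤ 2) {η : ℝ} (hη0 : 0 < η) (hη1 : η ≤ 1)
    (hgap : ∀ x : UnitAddTorus (Fin 3), torusStrainMidEig v x ≤ (1 - η) * torusStrainTopEig v x)
    {δ : ℝ} (hδ : 0 < δ) :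
    torusTopEigMoment q v - 2 * δ * ∫ x, torusStrainTopEig v x ^ (q - 1) ≤
      Real.sqrt (3 * (1 / (2 * η)) * δ ^ (q - 2)) * Real.sqrt (∫ x, ‖v x‖ ^ 2) *
        Real.sqrt (4 / (q * (q - 1)) * heatDissipation (torusTopEigMoment q) v) := by
  have hq1' : (1 : ℝ) ≤ q := hq1.le
  have hq0 : 0 < q := by linarith
  have hMs : ∀ i j, Torus.IsSmooth (cutProjPow δ q v i j) := fun i j =>
    isSmooth_cutProjPow hv hdiv q hδ hη0 hgap i j
  have hl0 : ∀ x, 0 ≤ torusStrainTopEig v x := fun x => by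
    rw [← lam_strainFlat]; exact lam_strainFlat_nonneg hv hdiv x
  have hlc : Continuous (torusStrainTopEig v) := continuous_torusStrainTopEig hv
  have hHc : Continuous fun x => cutPow δ q (torusStrainTopEig v x) := (continuous_cutPow hδ q).comp hlc
  have hΦ : torusTopEigMoment q v = ∫ x, torusStrainTopEig v x ^ q := by
    rw [torusTopEigMoment_eq hv hdiv q]
    exact integral_congr_ae (ae_of_all _ fun x => by show lam _ ^ q = _; rw [lam_strainFlat])
  set T : ℝ := heatDissipation (torusTopEigMoment q) v with hTdef
  -- (1) heat side and the density
  set ρ : UnitAddTorus (Fin 3) → ℝ := cutDensityPow δ q v with hρdef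
  obtain ⟨hρint, -⟩ := integral_cutDensityPow_le_add_of_le_two hv hdiv hq1 hq2 hη0 hgap hδ
  have hρle : ∫ x, ρ x ≤ 4 / (q * (q - 1)) * T :=
    integral_cutDensityPow_le_heat_of_le_two hv hdiv hq1 hq2 hη0 hgap hδ
  have hρx0 : ∀ x, 0 ≤ ρ x := fun x => cutDensityPow_nonneg_of_one_le hv hdiv hq1' hδ hη0 hgap x
  -- (2) gradient side, pointwise, with `λ₁^{q−2} ≤ δ^{q−2}` on the support
  set c₁ : ℝ := 1 / (2 * η) with hc₁
  have hc₁0 : 0 ≤ c₁ := by positivity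
  set D : ℝ := δ ^ (q - 2) with hDdef
  have hD0 : 0 ≤ D := Real.rpow_nonneg hδ.le _
  have hGle : ∀ x, ∑ k, ∑ i, ∑ j, (Torus.partialDeriv k (cutProjPow δ q v i j) x) ^ 2 ≤ c₁ * D * ρ x := by
    intro x
    have h := sum_sq_partialDeriv_cutProjPow_le_cutDensityPow_of_le_two hv hdiv hq1' hq2 hδ hη0 hη1 hgap x
    by_cases hlt : torusStrainTopEig v x < δ
    · simp_rw [partialDeriv_cutProjPow_eq_zero_of_lt hv hδ q hlt]
      simp only [ne_eq, OfNat.ofNat_ne_zero, not_false_eq_true, zero_pow, Finset.sum_const_zero]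
      exact mul_nonneg (mul_nonneg hc₁0 hD0) (hρx0 x)
    · have hL : torusStrainTopEig v x ^ (q - 2) ≤ D :=
        Real.rpow_le_rpow_of_nonpos hδ (not_lt.1 hlt) (by linarith)
      exact h.trans (mul_le_mul_of_nonneg_right (mul_le_mul_of_nonneg_left hL hc₁0) (hρx0 x))
  -- (3) moment side through the velocity
  have hIBP : ∫ x, ∑ i, ∑ j, torusStrainMatrix v x i j * cutProjPow δ q v i j x =
      -∫ x, ∑ j, v x j * ∑ i, Torus.partialDeriv i (cutProjPow δ q v i j) x :=
    integral_sum_strain_mul_eq_neg hv (N := fun i j => cutProjPow δ q v i j) hMs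
      (fun i j x => cutProjPow_symm δ q v i j x)
  have hstep : ∫ x, cutPow δ q (torusStrainTopEig v x) * torusStrainTopEig v x =
      -∫ x, ∑ j, v x j * ∑ i, Torus.partialDeriv i (cutProjPow δ q v i j) x := by
    rw [← hIBP]
    exact integral_congr_ae (ae_of_all _ fun x => (sum_strain_mul_cutProjPow δ q v x).symm)
  have hpt : ∀ x, -(∑ j, v x j * ∑ i, Torus.partialDeriv i (cutProjPow δ q v i j) x) ≤
      Real.sqrt (3 * c₁ * D) * (‖v x‖ * Real.sqrt (ρ x)) := by
    intro x
    have h1 := abs_sum_mul_le_norm_mul_sqrt (v x) (fun j => ∑ i, Torus.partialDeriv i (cutProjPow δ q v i j) x)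
    have h2 := sum_sq_sum_le_three_mul (fun i j => Torus.partialDeriv i (cutProjPow δ q v i j) x)
    have hdiag : ∑ i, ∑ j, (Torus.partialDeriv i (cutProjPow δ q v i j) x) ^ 2 ≤
        ∑ k, ∑ i, ∑ j, (Torus.partialDeriv k (cutProjPow δ q v i j) x) ^ 2 := by
      refine Finset.sum_le_sum fun i _ => ?_
      exact Finset.single_le_sum (f := fun i' => ∑ j, (Torus.partialDeriv i (cutProjPow δ q v i' j) x) ^ 2)
        (fun i' _ => Finset.sum_nonneg fun j _ => sq_nonneg _) (Finset.mem_univ i)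
    have h3 : ∑ i, ∑ j, (Torus.partialDeriv i (cutProjPow δ q v i j) x) ^ 2 ≤ c₁ * D * ρ x :=
      hdiag.trans (hGle x)
    have h4 : ∑ j, (∑ i, Torus.partialDeriv i (cutProjPow δ q v i j) x) ^ 2 ≤ 3 * c₁ * D * ρ x :=
      calc ∑ j, (∑ i, Torus.partialDeriv i (cutProjPow δ q v i j) x) ^ 2
          ≤ 3 * ∑ i, ∑ j, (Torus.partialDeriv i (cutProjPow δ q v i j) x) ^ 2 := h2
        _ ≤ 3 * (c₁ * D * ρ x) := by linarith
        _ = 3 * c₁ * D * ρ x := by ring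
    have h5 : Real.sqrt (∑ j, (∑ i, Torus.partialDeriv i (cutProjPow δ q v i j) x) ^ 2) ≤
        Real.sqrt (3 * c₁ * D) * Real.sqrt (ρ x) := by
      rw [← Real.sqrt_mul (by positivity)]
      exact Real.sqrt_le_sqrt h4
    have h6 := (neg_le_abs _).trans (h1.trans (mul_le_mul_of_nonneg_left h5 (norm_nonneg _)))
    calc -(∑ j, v x j * ∑ i, Torus.partialDeriv i (cutProjPow δ q v i j) x)
        ≤ ‖v x‖ * (Real.sqrt (3 * c₁ * D) * Real.sqrt (ρ x)) := h6
      _ = Real.sqrt (3 * c₁ * D) * (‖v x‖ * Real.sqrt (ρ x)) := by ring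
  have hInt1 : Integrable (fun x => ∑ j, v x j * ∑ i, Torus.partialDeriv i (cutProjPow δ q v i j) x) volume :=
    (continuous_finsetSum _ fun j _ => ((hv.apply j).continuous.mul
      (continuous_finsetSum _ fun i _ => ((hMs i j).partialDeriv i).continuous))).integrable_unitAddTorus
  -- the `L²` data: `f = ‖v‖`, `g = √ρ`
  set f : UnitAddTorus (Fin 3) → ℝ := fun x => ‖v x‖ with hfdef
  set g : UnitAddTorus (Fin 3) → ℝ := fun x => Real.sqrt (ρ x) with hgdef
  have hfc : Continuous f := hv.continuous.norm
  have hf0 : ∀ x, 0 ≤ f x := fun x => norm_nonneg _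
  have hg0 : ∀ x, 0 ≤ g x := fun x => Real.sqrt_nonneg _
  have hg2 : ∀ x, g x ^ 2 = ρ x := fun x => Real.sq_sqrt (hρx0 x)
  have hgm : AEStronglyMeasurable g volume := Real.continuous_sqrt.comp_aestronglyMeasurable hρint.aestronglyMeasurable
  have hf2int : Integrable (fun x => f x ^ 2) volume := (hfc.pow 2).integrable_unitAddTorus
  have hfgint : Integrable (fun x => f x * g x) volume := by
    refine Integrable.mono' (((hf2int.add hρint).div_const 2)) (hfc.aestronglyMeasurable.mul hgm)
      (ae_of_all _ fun x => ?_)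
    rw [Real.norm_eq_abs, abs_mul, abs_of_nonneg (hf0 x), abs_of_nonneg (hg0 x)]
    have := two_mul_le_add_sq (f x) (g x)
    rw [hg2 x] at this
    simp only [Pi.add_apply]
    linarith
  have hM1 : ∫ x, cutPow δ q (torusStrainTopEig v x) * torusStrainTopEig v x ≤
      Real.sqrt (3 * c₁ * D) * ∫ x, f x * g x := by
    rw [hstep, ← integral_neg, ← integral_const_mul]
    exact integral_mono hInt1.neg (hfgint.const_mul _) hpt
  -- Cauchy–Schwarz
  have hfL : MemLp f (ENNReal.ofReal 2) volume := hfc.memLp_of_hasCompactSupport (HasCompactSupport.of_compactSpace _)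
  have hgL : MemLp g (ENNReal.ofReal 2) volume := by
    rw [show ENNReal.ofReal 2 = 2 by norm_num]
    exact (memLp_two_iff_integrable_sq hgm).2 (hρint.congr (ae_of_all _ fun x => (hg2 x).symm))
  have hCS := integral_mul_le_Lp_mul_Lq_of_nonneg (μ := volume) Real.HolderConjugate.two_two
    (ae_of_all _ hf0) (ae_of_all _ hg0) hfL hgL
  have eF : ∫ x, f x ^ (2 : ℝ) = ∫ x, ‖v x‖ ^ 2 :=
    integral_congr_ae (ae_of_all _ fun x => by dsimp only; rw [Real.rpow_two])
  have eG : ∫ x, g x ^ (2 : ℝ) = ∫ x, ρ x :=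
    integral_congr_ae (ae_of_all _ fun x => by dsimp only; rw [Real.rpow_two, hg2 x])
  rw [eF, eG, ← Real.sqrt_eq_rpow, ← Real.sqrt_eq_rpow] at hCS
  have hs2 : Real.sqrt (∫ x, ρ x) ≤ Real.sqrt (4 / (q * (q - 1)) * T) := Real.sqrt_le_sqrt hρle
  have hM2 : ∫ x, f x * g x ≤ Real.sqrt (∫ x, ‖v x‖ ^ 2) * Real.sqrt (4 / (q * (q - 1)) * T) :=
    hCS.trans (mul_le_mul_of_nonneg_left hs2 (Real.sqrt_nonneg _))
  -- (4) the lower bound `Φ_q − 2δ∫λ₁^{q−1} ≤ ∫ H λ₁`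
  have hlow : torusTopEigMoment q v - 2 * δ * ∫ x, torusStrainTopEig v x ^ (q - 1) ≤
      ∫ x, cutPow δ q (torusStrainTopEig v x) * torusStrainTopEig v x := by
    have hq1c : Continuous fun x => torusStrainTopEig v x ^ (q - 1) :=
      hlc.rpow_const fun x => Or.inr (by linarith)
    have hqc : Continuous fun x => torusStrainTopEig v x ^ q := hlc.rpow_const fun x => Or.inr hq0.le
    have hI5 : Integrable (fun x => torusStrainTopEig v x ^ q) volume := hqc.integrable_unitAddTorus
    have hI6 : Integrable (fun x => 2 * δ * torusStrainTopEig v x ^ (q - 1)) volume :=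
      (hq1c.const_mul _).integrable_unitAddTorus
    have hI4 : Integrable (fun x => cutPow δ q (torusStrainTopEig v x) * torusStrainTopEig v x) volume :=
      (hHc.mul hlc).integrable_unitAddTorus
    have hpt' : ∀ x, torusStrainTopEig v x ^ q - 2 * δ * torusStrainTopEig v x ^ (q - 1) ≤
        cutPow δ q (torusStrainTopEig v x) * torusStrainTopEig v x := by
      intro x
      obtain ⟨-, h2⟩ := rpow_sub_cutPow_mem_of_one_lt hδ hq1 (hl0 x)
      have hl := hl0 x
      have e1 : torusStrainTopEig v x ^ q = torusStrainTopEig v x * torusStrainTopEig v x ^ (q - 1) := by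
        rw [show q = 1 + (q - 1) by ring, Real.rpow_add' hl (by linarith), Real.rpow_one]
        ring_nf
      have e2 : torusStrainTopEig v x ^ (q - 1) = torusStrainTopEig v x * torusStrainTopEig v x ^ (q - 2) := by
        rw [show q - 1 = 1 + (q - 2) by ring, Real.rpow_add' hl (by linarith), Real.rpow_one]
      have h3 := mul_le_mul_of_nonneg_left h2 hl
      rw [e1]
      nlinarith
    have hI56 : Integrable (fun x => torusStrainTopEig v x ^ q - 2 * δ * torusStrainTopEig v x ^ (q - 1)) volume :=
      hI5.sub hI6
    have hle := integral_mono hI56 hI4 hpt'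
    rw [integral_sub hI5 hI6, integral_const_mul, ← hΦ] at hle
    exact hle
  -- (5) assemble
  have hsc : 0 ≤ Real.sqrt (3 * c₁ * D) := Real.sqrt_nonneg _
  calc torusTopEigMoment q v - 2 * δ * ∫ x, torusStrainTopEig v x ^ (q - 1)
      ≤ ∫ x, cutPow δ q (torusStrainTopEig v x) * torusStrainTopEig v x := hlow
    _ ≤ Real.sqrt (3 * c₁ * D) * ∫ x, f x * g x := hM1
    _ ≤ Real.sqrt (3 * c₁ * D) * (Real.sqrt (∫ x, ‖v x‖ ^ 2) * Real.sqrt (4 / (q * (q - 1)) * T)) :=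
        mul_le_mul_of_nonneg_left hM2 hsc
    _ = Real.sqrt (3 * (1 / (2 * η)) * δ ^ (q - 2)) * Real.sqrt (∫ x, ‖v x‖ ^ 2) *
        Real.sqrt (4 / (q * (q - 1)) * T) := by rw [hc₁, hDdef]; ring

/-! ## 2. The node below `q = 2`, and for every real `q ≥ 6/5` -/

/-- **PROPOSITION L-λ(η) BELOW `q = 2`, KERNEL FORM.** Let `6/5 ≤ q ≤ 2`, `0 < η ≤ 1`, and let `K₀ ≥ 0`
satisfy the velocity brick `∫‖v‖² ≤ K₀Φ_q(v)^{2/q}` for the field `v` (smooth, divergence free on `T³`,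
`λ₂ ≤ (1−η)λ₁` pointwise). Then `(ηq(q−1)/(96(K₀+1))) · Φ_q(v) ≤ T_q(v)` — the cut-off level is
`δ = Φ_q^{1/q}/4`. [ours] -/
theorem topEigMoment_rpow_le_heatDissipation_of_gap_of_le_two (hv : Torus.IsSmooth v) (hdiv : Torus.IsDivFree v)
    {q : ℝ} (hq : 6 / 5 ≤ q) (hq2 : q ≤ 2) {η : ℝ} (hη0 : 0 < η) (hη1 : η ≤ 1)
    (hgap : ∀ x : UnitAddTorus (Fin 3), torusStrainMidEig v x ≤ (1 - η) * torusStrainTopEig v x)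
    {K₀ : ℝ} (hK0 : 0 ≤ K₀) (hK : ∫ x, ‖v x‖ ^ 2 ≤ K₀ * torusTopEigMoment q v ^ (2 / q)) :
    η * q * (q - 1) / (96 * (K₀ + 1)) * torusTopEigMoment q v ≤ heatDissipation (torusTopEigMoment q) v := by
  have hq1 : 1 < q := by linarith
  have hq1' : (1 : ℝ) ≤ q := hq1.le
  have hq0 : 0 < q := by linarith
  have hqm : 0 < q - 1 := by linarith
  set F : ℝ := torusTopEigMoment q v with hFdef
  set T : ℝ := heatDissipation (torusTopEigMoment q) v with hTdef
  have hF0 : 0 ≤ F := torusTopEigMoment_nonneg q v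
  have hT0 : 0 ≤ T :=
    heatDissipation_nonneg_of_admissible hq1' convexOn_lam lipschitzWith_lam
      (fun _ hv hdiv x => lam_strainFlat_nonneg hv hdiv x)
      (fun _ hv hdiv => torusTopEigMoment_eq hv hdiv q) hv hdiv
  have hK1 : 0 < K₀ + 1 := by linarith
  have hrate0 : 0 ≤ η * q * (q - 1) / (96 * (K₀ + 1)) := by positivity
  rcases hF0.eq_or_lt with hF00 | hFpos
  · rw [← hF00, mul_zero]; exact hT0
  -- the level `δ = Λ/4`, `Λ = F^{1/q}`
  set Λ : ℝ := F ^ (1 / q) with hΛdef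
  have hΛ0 : 0 < Λ := Real.rpow_pos_of_pos hFpos _
  have hΛq : Λ ^ q = F := by
    rw [hΛdef, ← Real.rpow_mul hF0, one_div_mul_cancel hq0.ne', Real.rpow_one]
  set δ : ℝ := Λ / 4 with hδdef
  have hδ : 0 < δ := by positivity
  -- Jensen: `∫λ₁^{q−1} ≤ Λ^{q−1}`
  have hJ : ∫ x, torusStrainTopEig v x ^ (q - 1) ≤ Λ ^ (q - 1) := by
    have h := rpow_integral_topEig_rpow_le hv hdiv hqm (by linarith : q - 1 < q)
    have hI0 : 0 ≤ ∫ x, torusStrainTopEig v x ^ (q - 1) := integral_nonneg fun x =>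
      Real.rpow_nonneg (by rw [← lam_strainFlat]; exact lam_strainFlat_nonneg hv hdiv x) _
    have h2 := Real.rpow_le_rpow (Real.rpow_nonneg hI0 _) h hqm.le
    rw [← Real.rpow_mul hI0, one_div_mul_cancel hqm.ne', Real.rpow_one] at h2
    exact h2
  -- `2δΛ^{q−1} = F/2`
  have hΛpow : Λ * Λ ^ (q - 1) = F := by
    rw [← hΛq, show q = 1 + (q - 1) by ring, Real.rpow_add hΛ0, Real.rpow_one]
    ring_nf
  have hlow : F / 2 ≤ F - 2 * δ * ∫ x, torusStrainTopEig v x ^ (q - 1) := by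
    have h1 : 2 * δ * ∫ x, torusStrainTopEig v x ^ (q - 1) ≤ 2 * δ * Λ ^ (q - 1) :=
      mul_le_mul_of_nonneg_left hJ (by positivity)
    have e : 2 * δ * Λ ^ (q - 1) = F / 2 := by rw [hδdef, ← hΛpow]; ring
    linarith
  -- the estimate at `δ`
  have hest := cut_topEigMoment_estimate_of_le_two hv hdiv hq1 hq2 hη0 hη1 hgap hδ
  -- `δ^{q−2} F^{2/q} ≤ 4F`
  have hDF : δ ^ (q - 2) * (K₀ * F ^ (2 / q)) ≤ 4 * (K₀ + 1) * F := by
    have hF2 : F ^ (2 / q) = Λ ^ (2 : ℝ) := by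
      rw [hΛdef, ← Real.rpow_mul hF0]; congr 1; ring
    have hδpow : δ ^ (q - 2) = Λ ^ (q - 2) / (4 : ℝ) ^ (q - 2) := by
      rw [hδdef, Real.div_rpow hΛ0.le (by norm_num)]
    have h4 : (1 : ℝ) / 4 ≤ (4 : ℝ) ^ (q - 2) := by
      have h := Real.rpow_le_rpow_of_exponent_le (show (1 : ℝ) ≤ 4 by norm_num) (show (-1 : ℝ) ≤ q - 2 by linarith)
      rw [Real.rpow_neg_one] at h
      simpa using h
    have h4pos : 0 < (4 : ℝ) ^ (q - 2) := Real.rpow_pos_of_pos (by norm_num) _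
    have hΛΛ : Λ ^ (q - 2) * Λ ^ (2 : ℝ) = F := by
      rw [← Real.rpow_add hΛ0, show q - 2 + 2 = q by ring, hΛq]
    have e : δ ^ (q - 2) * (K₀ * F ^ (2 / q)) = K₀ * F / (4 : ℝ) ^ (q - 2) := by
      rw [hδpow, hF2]
      field_simp
      linear_combination K₀ * hΛΛ
    rw [e, div_le_iff₀ h4pos]
    have hKF : 0 ≤ K₀ * F := mul_nonneg hK0 hF0
    nlinarith
  -- combine: `F/2 ≤ √(3/(2η) δ^{q−2}) √(∫‖v‖²) √(4T/(q(q−1)))`, square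
  set A : ℝ := Real.sqrt (3 * (1 / (2 * η)) * δ ^ (q - 2)) with hAdef
  set B : ℝ := Real.sqrt (∫ x, ‖v x‖ ^ 2) with hBdef
  set R : ℝ := Real.sqrt (4 / (q * (q - 1)) * T) with hRdef
  have hmain : F / 2 ≤ A * B * R := hlow.trans hest
  have hA0 : 0 ≤ A := Real.sqrt_nonneg _
  have hB0 : 0 ≤ B := Real.sqrt_nonneg _
  have hR0 : 0 ≤ R := Real.sqrt_nonneg _
  have hsq : (F / 2) ^ 2 ≤ (A * B * R) ^ 2 := pow_le_pow_left₀ (by positivity) hmain 2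
  have hA2 : A ^ 2 = 3 * (1 / (2 * η)) * δ ^ (q - 2) :=
    Real.sq_sqrt (mul_nonneg (by positivity) (Real.rpow_nonneg hδ.le _))
  have hB2 : B ^ 2 ≤ K₀ * F ^ (2 / q) := by
    rw [hBdef, Real.sq_sqrt (integral_nonneg fun x => sq_nonneg _)]; exact hK
  have hR2 : R ^ 2 = 4 / (q * (q - 1)) * T := Real.sq_sqrt (by positivity)
  have hprod : (A * B * R) ^ 2 ≤ 3 * (1 / (2 * η)) * (4 * (K₀ + 1) * F) * (4 / (q * (q - 1)) * T) := by
    rw [mul_pow, mul_pow, hA2, hR2]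
    have h1 : 3 * (1 / (2 * η)) * δ ^ (q - 2) * B ^ 2 ≤ 3 * (1 / (2 * η)) * (4 * (K₀ + 1) * F) := by
      have h := mul_le_mul_of_nonneg_left (hB2.trans' le_rfl) (Real.rpow_nonneg hδ.le (q - 2))
      have h' : δ ^ (q - 2) * B ^ 2 ≤ 4 * (K₀ + 1) * F := (mul_le_mul_of_nonneg_left hB2
        (Real.rpow_nonneg hδ.le _)).trans hDF
      have := mul_le_mul_of_nonneg_left h' (show (0 : ℝ) ≤ 3 * (1 / (2 * η)) by positivity)
      linarith [this]
    exact mul_le_mul_of_nonneg_right h1 (by positivity)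
  have hfin : (F / 2) ^ 2 ≤ 3 * (1 / (2 * η)) * (4 * (K₀ + 1) * F) * (4 / (q * (q - 1)) * T) := hsq.trans hprod
  -- `F²/4 ≤ (24(K₀+1)/(ηq(q−1))) F T`, divide by `F > 0`
  have e : 3 * (1 / (2 * η)) * (4 * (K₀ + 1) * F) * (4 / (q * (q - 1)) * T) =
      F * (24 * (K₀ + 1) / (η * q * (q - 1)) * T) := by
    field_simp
    ring
  rw [e, div_pow, show (2 : ℝ) ^ 2 = 4 by norm_num, sq] at hfin
  have hfin' : F / 4 ≤ 24 * (K₀ + 1) / (η * q * (q - 1)) * T := by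
    have h2 : F * (F / 4) ≤ F * (24 * (K₀ + 1) / (η * q * (q - 1)) * T) := by
      have e2 : F * (F / 4) = F * F / 4 := by ring
      rw [e2]
      exact hfin
    exact le_of_mul_le_mul_left h2 hFpos
  have hηq : 0 < η * q * (q - 1) := by positivity
  calc η * q * (q - 1) / (96 * (K₀ + 1)) * F
      = η * q * (q - 1) / (24 * (K₀ + 1)) * (F / 4) := by field_simp; ring
    _ ≤ η * q * (q - 1) / (24 * (K₀ + 1)) * (24 * (K₀ + 1) / (η * q * (q - 1)) * T) :=
        mul_le_mul_of_nonneg_left hfin' (by positivity)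
    _ = T := by field_simp

/-- **THE NODE `TopEigGapCoercivePos q η` HOLDS for every `6/5 ≤ q < 2` and `η > 0`** — Proposition
L-λ(η) below `q = 2` on the WHOLE top-gap class (no amplitude floor), existential rate
`ηq(q−1)/(96(K₀+1))` for `η ≤ 1` through the velocity brick's constant. [ours] -/
theorem topEigGapCoercivePos_of_lt_two {q η : ℝ} (hq : 6 / 5 ≤ q) (hq2 : q < 2) (hη0 : 0 < η) :
    TopEigGapCoercivePos (d := Fin 3) q η := by
  suffices h : ∀ η' : ℝ, 0 < η' → η' ≤ 1 → TopEigGapCoercivePos (d := Fin 3) q η' by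
    rcases le_or_gt η 1 with h1 | h1
    · exact h η hη0 h1
    · exact (h 1 one_pos le_rfl).of_le_eta h1.le
  intro η' hη0' hη1'
  obtain ⟨K₀, hK0, hK⟩ := exists_integral_norm_sq_le_topEigMoment_rpow hq hq2.le
  refine ⟨η' * q * (q - 1) / (96 * (K₀ + 1)), by
    have : 0 < q - 1 := by linarith
    have : 0 < K₀ + 1 := by linarith
    positivity, ?_⟩
  intro _ u hu hdiv hmean hcls
  exact topEigMoment_rpow_le_heatDissipation_of_gap_of_le_two hu hdiv hq hq2.le hη0' hη1' hcls hK0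
    (hK u hu hdiv hmean)

/-- **THE NODE `TopEigGapCoercivePos q η` FOR EVERY REAL `q ≥ 6/5` AND `η > 0`** (`q < 2`: this file;
`q ≥ 2`: the tree's `topEigGapCoercivePos_of_ge_two`). Proposition L-λ(η) — on the class `λ₂ ≤ (1−η)λ₁`
the heat price of `Φ_q` is coercive — for every real `q ≥ 6/5`. [ours] -/
theorem topEigGapCoercivePos_of_ge_six_fifths {q η : ℝ} (hq : 6 / 5 ≤ q) (hη0 : 0 < η) :
    TopEigGapCoercivePos (d := Fin 3) q η := by
  rcases lt_or_ge q 2 with h2 | h2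
  · exact topEigGapCoercivePos_of_lt_two hq h2 hη0
  · exact topEigGapCoercivePos_of_ge_two h2 hη0

/-- The same in the `HeatCoerciveOn` vocabulary of the class records: for `6/5 ≤ q` and `η > 0` there is
`c > 0` with `HeatCoerciveOn (StrainGapClass η) Φ_q c`. [ours, bookkeeping] -/
theorem topEigHeatCoerciveOn_gap_of_ge_six_fifths {q η : ℝ} (hq : 6 / 5 ≤ q) (hη0 : 0 < η) :
    ∃ c : ℝ, 0 < c ∧ HeatCoerciveOn (StrainGapClass (d := Fin 3) η) (torusTopEigMoment q) c :=
  topEigGapCoercivePos_of_ge_six_fifths hq hη0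

/-- **THE COROLLARY OF SIEVELD §3.4b, UNCONDITIONAL FOR EVERY REAL `q ≥ 6/5`.** If Lemma L-λ(q)
(`TopEigHeatCoercivePos q`) FAILS, then for EVERY `η > 0` and every small rate the violators live OUTSIDE
the class `λ₂ ≤ (1−η)λ₁`: a violating sequence develops near-biaxial points. [ours] -/
theorem violators_outside_every_gap_of_not_pos_of_ge_six_fifths {q η : ℝ} (hq : 6 / 5 ≤ q) (hη0 : 0 < η)
    (hfail : ¬ TopEigHeatCoercivePos (d := Fin 3) q) :
    ∃ c₀ : ℝ, 0 < c₀ ∧ ∀ c : ℝ, 0 < c → c ≤ c₀ →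
      ∃ v : UnitAddTorus (Fin 3) → EuclideanSpace ℝ (Fin 3), Torus.IsSmooth v ∧ Torus.IsDivFree v ∧
        Torus.HasZeroMean v ∧ ¬ StrainGapClass η v ∧
        heatDissipation (torusTopEigMoment q) v < c * torusTopEigMoment q v :=
  violators_outside_gap_of_not_pos (topEigGapCoercivePos_of_ge_six_fifths hq hη0) hfail

end TopEig

end Summit.NavierStokesRegularity.FunctionalMining

end
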